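import Summits.BirchSwinnertonDyer.Rank1Residual.X11b.CastellaErratumCongruenceLimit
import Mathlib.Data.Nat.Totient
import Mathlib.Data.Nat.Prime.Factorial
import Mathlib.FieldTheory.Finite.Basic
import HarnessLib

/-!
# X11b, route R1 — the erratum's Thm. 2.3 (the OPEN atom): its printed proof as a skeleton, the
# approximating weights `k_m`, and the standing hypotheses of the cited inputs made kernel-precise

HONEST FRAMING (cell `b2b-bsdres`, run/shared/lean/b2b/bsd-rank1-residual/, verbatim in every
file): the goal of the cell is to DELETE the COMBINATION-SHAPED residual classes of the
Birch–Swinnerton-Dyer formula for ALL analytic-rank `≤ 1` elliptic curves over `ℚ` — "full BSD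
formula for every rank `≤ 1` curve in class `C`" assembled STRICTLY from published theorems — so
that the rank-`≤ 1` remainder becomes exactly the CONSTRUCTION-SHAPED classes, which are TYPED
(missing-input `Prop`s), NOT attempted. This is not "finishing BSD". Sub-cell
`b2b-bsdres-multr1-p1` (X11b via the re-proof of Castella 2018 Thm. A along the author's erratum):
a RESEARCH ROUTE; no claim beyond the stated class; X11b stays CONSTRUCTION-SHAPED; nothing here
changes a label; no named fact is introduced (theorems and shape-only bookkeeping predicates;
no `sorry`). NOTHING in this file claims that any published or announced theorem is false: §3
records, as decidable arithmetic, which STANDING HYPOTHESES of the papers cited in the erratum's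
proof of Thm. 2.3 are met or not met by the weights at which the erratum invokes them — queries
for the author / the literature seat (cell audit `X11B-AUDIT.md` §5 Q1; this unit's Q3), not
findings against the results.

## Where this sits in route R1

After gens 1–4 (30 files under `X11b/`) route R1 reads: `RouteGoal` (BSD(E,p) for every rank-one
pair on `ChainLocus`) ⇐ 10 PUBLISHED named facts + the OPEN input (A) = Cas18 display (5.3); and
(A) ⇐ [PUB shadow links, `CastellaErratumLinks`] ∘ [erratum pp. 2–4: Lemma 2.1, the p. 4 limiting
argument, Pontryagin duality, base change, evaluation at `𝟙` — ALL KERNEL] ∘ [erratum **Thm. 2.3**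
for the approximating forms `g_m`: OPEN]. This file is about the last bracket ONLY: (§1) the
printed proof of Thm. 2.3 as an ideal-theoretic skeleton whose inputs are its displayed
divisibilities (2.3), (2.5) BY NAME; (§2) the arithmetic of the approximating weights `k_m` of the
proof of Thm. 1.1; (§3) the standing hypotheses of [CH18], [LV19], [FW21] (verbatim below)
evaluated at those weights; (§4) the input "`L_p(f) ≠ 0`".

## The erratum's Thm. 2.3 and its proof, verbatim (F. Castella, *Erratum to "On the p-part of
## the Birch–Swinnerton-Dyer formula for multiplicative primes"*, web, n.d., pp. 3–4; UNREFEREED;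
## = arXiv:2409.01360v1 Thm. 3.1's input) [Castella2018Erratum]

Statement: verbatim in the module docstring of `CastellaErratum.lean` (p. 3; hypotheses (i)–(iv);
conclusion "`X^Σ_ac(A_g)` is `Λ_𝒪`-torsion, and `Ch_{Λ_𝒪}(X^Σ_ac(A_g))Λ_𝒪^{ur} = (L^Σ_p(g))`").
"*Proof.* The argument goes along the same lines as the proof of [Cas18, Thm. 4.1] (contained in
[Cas17] and [Wan21]) in the weight 2 case. Let `z_{g,c} ∈ Sel(H_c, T_g)` be the system of
generalized Heegner classes defined in [CH18, (4.7)] (taking `χ = 1` in loc. cit.), where `c` runs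
over the positive integers prime to `M`, and `H_c` is the ring class field of `K` of conductor `c`.
Put `𝐓_g := T_g ⊗_𝒪 Λ_𝒪`, where `G_K` acts on `Λ_𝒪` through `Ψ`, and let `κ_{g,∞} ∈ H¹(K, 𝐓_g)`
be the Heegner class constructed in [CH18, § 5.2] from the classes `z_{g,p^m}` for varying
`m ≥ 0`. By [LV19, Thm. 4.7], there is a Kolyvagin system (2.1)
`κ^{Hg}_g = {κ^{Hg}_{g,n}}_{n∈𝒩} ∈ 𝐊𝐒(𝐓_g, ℱ_Λ, ℒ)` for the Selmer structure `ℱ_Λ` in [op. cit.,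
§ 3.3], where `ℒ` is a certain set of primes inert in `K` (see [LV19, § 4.1]), and `𝒩` is the set
of squarefree products of primes `ℓ ∈ ℒ`. In the same way as in [CGLS22, Rem. 4.1.3], we see that
`κ^{Hg}_{g,1}` agrees with `κ_{g,∞}` up to a `p`-adic unit. Since `κ_{g,∞}` is not `Λ_𝒪`-torsion
by [CH18, Thm. 6.1], the Kolyvagin system (2.1) is non-trivial, and so by [CGS23, Thm. 5.5.1] the
modules `X_ord(A_g) := H¹_{ℱ_Λ}(K, M_g)^*` and `H¹_{ℱ_Λ}(K, 𝐓_g)` both have `Λ_𝒪`-rank one, and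
we have the divisibility (2.2) `Ch_{Λ_𝒪}(X_ord(A_g)_tors) ⊃ Ch_{Λ_𝒪}(H¹_{ℱ_Λ}(K, 𝐓_g)/Λ_𝒪 κ_{g,∞})²`,
where the subscript tors denotes the maximal `Λ_𝒪`-torsion submodule. The divisibility directly
obtained in loc. cit. is up to powers of `p`, an ambiguity that can be removed if the constants
`C₁` and `C₂` defined as in [CGLS22, § 3.3.1] can both be taken to be zero. As noted in [loc.
cit., Rem. 3.3.5], the irreducibility of `ρ̄_g` implies that `C₂ = 0`. On the other hand, `C₁` is
a `p`-power exponent sufficient to annihilate the kernel of the restriction map in the proof of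
[CGLS22, Prop. 3,3,6], and it follows from [Cha05, Thm. 2] (see also [MN19, (0.9)]) that under
hypothesis (i) one may take `C₂ = 0`. Thus the divisibility (2.2) holds in `Λ_𝒪`. Using the
explicit reciprocity law for `κ_{g,∞}` in [CH18, Thm. 5.7], the same global duality argument as in
[BCK21, Thm. 5.2] shows that the module `X_ac(A_g)` is `Λ_𝒪`-torsion, and that (2.2) implies the
divisibility (2.3) `Ch_{Λ_𝒪}(X_ac(A_g))Λ_𝒪^{ur} ⊃ (L_p(g))` in `Λ_𝒪^{ur}`.
Conversely, let `Λ̃_𝒪 = 𝒪[[Gal(K̃_∞/K)]]` be the Iwasawa algebra for the `ℤ_p²`-extension `K̃_∞/K`,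
and put `Λ̃_𝒪^{ur} := Λ̃_𝒪 ⊗̂_{ℤ_p} R₀`. For any finite set `Σ` of primes of `K` away from `p`, let
`X^Σ_K(A_g)` denote the `Σ`-imprimitive Selmer group defined as in [Cas18, § 2.1] with `K̃_∞` in
place of `K_∞`, omitting `Σ` from the notation if `Σ = ∅`. By [FW21, Thm. 4.41], we then have the
divisibility (2.4) `Ch_{Λ̃_𝒪}(X_K(A_g))Λ̃_𝒪^{ur} ⊂ (L^{Gr}_p(g))` in `Λ̃_𝒪^{ur}`, where `L^{Gr}_p(g)`
is a certain two-variable `p`-adic `L`-function deduced from [EW16]. (Note that the proof of this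
integral divisibility uses the `μ = 0` result of [Hsi14, Thm. B].) By [FO12, Cor. 7.2.1],
`L^{Gr}_p(g)` agrees (up to a unit) with the product of a two-variable Hida `p`-adic Rankin
`L`-series, an anticyclotomic Katz `p`-adic `L`-function, and the class number of `K`. As a
result, by the same calculation as in [CGS23, Prop. 1.4.5], letting `L^{Gr,Σ}_p(g)_ac` denote the
image of the `Σ`-imprimitive `L^{Gr,Σ}_p(g)` (defined in the same manner as in [Cas18, (3.1)])
under the natural projection `Λ̃_𝒪 → Λ_𝒪`, we have `L^{Gr,Σ}_p(g)_ac = L^Σ_p(g)` up to a `p`-adic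
unit. Taking a `Σ` that contains all primes dividing `M`, by [JSW17, Cor. 3.4.2] it follows that
(2.4) yields the divisibility (2.5) `Ch_{Λ_𝒪}(X^Σ_ac(A_g))Λ_𝒪^{ur} ⊂ (L^Σ_p(g))` in `Λ_𝒪^{ur}`.
Since we have seen that `X^Σ_ac(A_g)` is `Λ_𝒪`-torsion, by the same argument as in [JSW17, Thn.
6.1.6] the divisibility (2.5) for `Σ` containing all the bad primes implies the same divisibility
for any `Σ`. Together with (2.3), this concludes the proof. □"
p. 4 (proof of Thm. 1.1): "for each `m ≥ 1` there exists (a) a `p`-ordinary newform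
`g_m ∈ S_{k_m}(Γ₀(M))` defined over `𝒪` of weight `k_m > 2` with `k_m ≡ 2 (mod p − 1)`; (b) a
`G_ℚ`-stable lattice `T_{g_m} ⊂ V_{g_m}` and an isomorphism `T_{g_m}/p^m T_{g_m} ≃ T/p^m T` as
`𝒪[G_ℚ]`-modules; … Indeed, (a) and (b) follow from Hida theory (see the discussion in [Ski16,
§ 2.6])"; footnote 1: "the hypothesis that `ρ̄_{g_m} ≃ E[p]` is irreducible as a `G_ℚ`-module and
ramified at some prime `q ∥ N` nonsplit in `K` implies that `ρ̄_{g_m}|_{G_K}` is irreducible, see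
[Ski20, Lem. 2.8.1]. Moreover, by "rigidity of automorphic types" [FO12, Lem. 2.14], condition
(iii) in Theorem 1.1 implies conditions (iii) and (iv) in Theorem 2.3."

## The standing hypotheses of the three load-bearing cited inputs, verbatim

* **[CH18]** F. Castella, M.-L. Hsieh, *Heegner cycles and `p`-adic `L`-functions*, Math. Ann.
  370 (2018) 567–628 = arXiv:1505.08165 [CastellaHsieh2018] (read: TeX p0003 L32–40, p0012 L5–8,
  p0021 L36–42, p0024 L62–75). p. 1: "Let `f ∈ S^{new}_{2r}(Γ₀(N))` be a newform of weight `2r`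
  and level `N`. Fix an odd prime `p ∤ N`." §1: "**Hypothesis (H).** The following hypotheses are
  assumed throughout. (a) `p ∤ 2(2r−1)!Nφ(N)`; (b) the conductor of `χ` is prime to `N`; (c) `N`
  is a product of primes split in `𝒦`; (d) `p = 𝔭𝔭̄` is split in `𝒦`". §4.1 (where the cycles and
  the classes (4.7) are defined): "We assume the (string) Heegner condition (Heeg) `N` is a product
  of primes split in `𝒦`. … If `r > 1`, we further assume that (can) `D_K = 4` or `D_K` is odd or
  `8 ∣ D_K`."; §4.2: "Let `p` be a prime with `p ∤ 2(2r−1)!Nφ(N)`."; §6.1: "Hypothesis (H). (a)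
  `p ∤ 2(2r−1)!Nφ(N)`; (b) (Heeg) and (can); (c) `(c,N) = 1`; (d) `p𝒪_K = 𝔭𝔭̄`"; §6 proofs:
  "Suppose that `p > 2r−1`. … By the hypothesis `p > 2r−1`, the Bloch–Kato group … admits a
  description in terms of Fontaine–Laffaille modules".
* **[LV19]** M. Longo, S. Vigni, *Kolyvagin systems and Iwasawa theory of generalized Heegner
  cycles*, Kyoto J. Math. 59 (2019) 717–746 = arXiv:1605.03168 [LongoVigni2019] (read: TeX p0003
  L11, p0005 L46–79). p. 1: "let `k ≥ 4` be an even integer and let `f` be a normalized newform of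
  weight `k` and level `Γ₀(N)` … Fix an imaginary quadratic field `K` of discriminant coprime to
  `Np` in which all the prime factors of `N` split and let `p` be a prime number not dividing `N`."
  §2.2: "let `Ξ` be the set of prime numbers `p` satisfying at least one of the following
  conditions: • `p ∣ 6N(k−2)!φ(N)c_f`; • the image of the `p`-adic representation `ρ_{f,p} : G_ℚ →
  GL₂(𝒪_F ⊗ ℤ_p)` … does not contain the set `{g ∈ GL₂(𝒪_F ⊗ ℤ_p) | det(g) ∈ (ℤ_p^×)^{k−1}}`. …
  **Definition 2.1.** The triple `(f,K,𝔭)` is admissible if • `p ∉ Ξ ∪ {ℓ prime : ℓ ∣ h_K}`; • `p`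
  does not ramify in `F`; • `p` splits in `K`; • `a_p ∈ 𝒪_𝔭^×`. … **Assumption 2.3.** The triple
  `(f,K,𝔭)` is admissible."
* **[FW21]** O. Fouquet, X. Wan, *The Iwasawa Main Conjecture for universal families of modular
  motives*, arXiv:2107.13726 (PREPRINT, unrefereed) [FouquetWan2021] (read: TeX p0044 L73 ff.).
  "**Theorem 4.41.** Let `f ∈ S_k(Γ₀(N))` be an eigencuspform of even weight `k` satisfying the
  following assumptions. • `ρ̄_f|G_𝒦` is absolutely irreducible. • `ρ_f|G_{ℚ_p}` is a crystalline
  representation. Moreover either `ρ̄_f|_{G_{ℚ_p}}` is absolutely irreducible, or `f` is ordinary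
  at `p`. • There exists `q ∥ N` (in particular `q ∤ p`) which is not split in `𝒦`. • If `ℓ ∣ N` is
  not split in `𝒦`, then `ℓ ∥ N`. Moreover if `2` is non-split in `𝒦`, then `2 ∥ N`. Then the
  following inclusion of ideals of `𝒪^{ur}[[Γ_𝒦]]` holds
  `char_{𝒪^{ur}[[Γ_𝒦]]}(X^{Gr}_𝒦(f) ⊗_𝒪 𝒪^{ur}) ⊆ (ℒ^{Gr}_𝒦(f))` up to height-one primes which are
  pullbacks of primes in `𝒪[[Γ⁺]]`. Assume in addition that the following assumption holds. • If
  `ℓ ∣ N` is not split in `𝒦`, then `ℓ` is ramified in `𝒦` and `π(f)_ℓ` is a special Steinberg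
  representation twisted by `χ_{ur}` for `χ_{ur}` the unramified character sending `ℓ` to
  `(−1)ℓ^{k/2−1}`. Then `char_{𝒪^{ur}[[Γ_𝒦]]}(X^{Gr}_𝒦(f) ⊗_𝒪 𝒪^{ur}) ⊆ (ℒ^{Gr}_𝒦(f))` holds."

## What the kernel records here (bookkeeping; queries, NOT claims against any theorem)

(§2) The forms `g_m` of the proof of Thm. 1.1 have weights `k_m > 2`, `k_m ≡ 2 (mod p−1)`; the
weights of [Ski16, § 2.6] are `k ≡ 2 (mod (p−1)p^{m−1})`, for which Euler's theorem gives the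
congruence of weight characters `u^{k−2} ≡ 1 (mod p^m)` for every unit `u` (`exists_approxWeight`,
`pow_sub_two_modEq_one`). (§3) Consequently `p ≤ k_m − 1` for EVERY such weight
(`prime_le_sub_one_of_weight`), so with `k_m = 2r`: `p ∣ (2r−1)!` and CH18's Hypothesis
(H)(a) "`p ∤ 2(2r−1)!Nφ(N)`" is NOT met at any `g_m` (`dvd_hypHa_modulus_of_weight`) — CH18's
(4.7), §5.2, Thm. 5.7, Thm. 6.1 are invoked in the proof of Thm. 2.3 for these `g_m`
(X11B-AUDIT §5 Q1, x11b); LV19's first `Ξ`-clause "`p ∣ 6N(k−2)!φ(N)c_f`" holds (so `(g_m,K,𝔭)`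
is NOT admissible) as soon as `m ≥ 2` (`dvd_xi_modulus_of_weight`), while the first weight
`k_1 = p+1` escapes it (`not_prime_dvd_factorial_first_weight`); and FW21 Thm. 4.41 carries
NO weight or factorial condition (its local hypothesis is "crystalline at `p`", the case `p ∤ M`),
and its other bullets are Thm. 2.3 (ii)–(iv) under the Heegner hypothesis, up to "absolutely
irreducible" versus the erratum's (i) "irreducible" (footnote 1, [Ski20, Lem. 2.8.1]). Two more standing conditions of the Euler-system inputs are not about
weights and are only RECORDED (not decidable here): CH18 §4.1 (Heeg) "`N` is a product of primes
split in `𝒦`" and LV19 "discriminant coprime to `Np`, all prime factors of `N` split" versus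
Thm. 2.3 (iii) "a prime `q ∥ M` nonsplit in `K`" with `𝒪_K/𝔐 ≃ ℤ/M` (so `q` RAMIFIED in `K`) —
this unit's query Q3 (INBOX 2026-08-20T03:55Z); and CH18 (can) for `r > 1` when `q = 2`. The
erratum does not comment on (H)(a), (Heeg), (can) or `Ξ`; whether the Λ-adic statements it uses
from [CH18]/[LV19] hold outside those standing hypotheses (e.g. via [Cas20]'s big Heegner points,
which the erratum cites for (c) and for the reciprocity law at `f`) is for the author / the
literature seat. NET READING of the OPEN atom after this file: Thm. 2.3 for the `g_m` =
{(2.3): Euler-system divisibility, whose printed inputs [CH18]/[LV19] are invoked OUTSIDE their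
standing (H)(a)/`Ξ`/(Heeg) hypotheses at every `m` (resp. every `m ≥ 2`)} + {(2.5) ⇐ (2.4) =
[FW21, Thm. 4.41], PREPRINT, hypotheses met as printed} + {published comparisons [FO12], [CGS23,
Prop. 1.4.5], [JSW17, Cor. 3.4.2, Thm. 6.1.6], [BCK21, Thm. 5.2], [Cha05]/[MN19], [CGLS22]}.
(§1) The proof's last two sentences — `Σ`-reduction of the divisibility (2.5) and "Together with
(2.3), this concludes the proof" — are the kernel theorems `le_span_singleton_of_imprimitive`,
`charIdeal_eq_of_thm23_inputs`. (§4) In route R1's application (`f = f_E`, `r_an(E) = 1`) the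
skeleton input "`L_p(f) ≠ 0`" needs no appeal to [CV07]: by the PUB link (BDP) (Cas18 Thm. 3.2,
`LambdaAdicShadow.WaldspurgerAt`) `L_p(f)(𝟙) = u·((1 − a_p p⁻¹) log_ω P_K)² ≠ 0` for the
non-torsion Heegner point `P_K`, and a power series with nonzero constant term is nonzero
(`ne_zero_of_constantCoeff_ne_zero`).

References: [Castella2018Erratum] pp. 3–4; [CastellaHsieh2018] §1, §4.1–4.2, §6.1; [LongoVigni2019]
§1, §2.2; [FouquetWan2021] Thm. 4.41; [Skinner2016PacificMC] §2.6; [JetchevSkinnerWan2017] Thm. 6.1.6.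
-/

noncomputable section

open scoped Nat

namespace Summit.BirchSwinnertonDyer.Rank1Residual.X11b.Thm23

/-! ### §1 The last two steps of the printed proof of Thm. 2.3 as ideal bookkeeping -/

section Skeleton

variable {R : Type*} [CommRing R] [IsDomain R]

/-- **`Σ`-reduction of a divisibility** (erratum p. 4: "by the same argument as in [JSW17, Thn.
6.1.6] the divisibility (2.5) for `Σ` containing all the bad primes implies the same divisibility
for any `Σ`", here from `Σ` down to a smaller set): if `Ch(X^Σ) = Ch(X)·(P)` and `L^Σ ~ L·P` for
the same NONZERO Euler factor `P` (inputs: the exact sequence of Selmer groups / the interpolation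
property — not proved here), then `Ch(X^Σ) ⊆ (L^Σ)` gives `Ch(X) ⊆ (L)`. Cancellation of a nonzero
principal ideal in a domain (companion of `CongruenceLimit.charIdeal_eq_span_of_imprimitive`, the
equality form). [cite: JetchevSkinnerWan2017, Thm. 6.1.6 (shape of the reduction step)] -/
theorem le_span_singleton_of_imprimitive {C CS : Ideal R} {L LS P : R} (hP : P ≠ 0)
    (hC : CS = C * Ideal.span {P}) (hL : Associated LS (L * P)) (h : CS ≤ Ideal.span {LS}) :
    C ≤ Ideal.span {L} := by
  rw [hC, Ideal.span_singleton_eq_span_singleton.mpr hL, ← Ideal.span_singleton_mul_span_singleton,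
    mul_comm C, mul_comm (Ideal.span {L})] at h
  exact (Ideal.span_singleton_mul_right_mono hP).mp h

/-- The opposite transport ((2.3) is stated for `Σ = ∅`): a lower bound `(L) ⊆ Ch(X)` propagates
UP to `(L^Σ) ⊆ Ch(X^Σ)` under the same two factorisations (no cancellation needed). [folklore] -/
theorem span_singleton_le_of_imprimitive {C CS : Ideal R} {L LS P : R}
    (hC : CS = C * Ideal.span {P}) (hL : Associated LS (L * P)) (h : Ideal.span {L} ≤ C) :
    Ideal.span {LS} ≤ CS := by
  rw [hC, Ideal.span_singleton_eq_span_singleton.mpr hL, ← Ideal.span_singleton_mul_span_singleton]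
  exact Ideal.mul_mono_left h

/-- **"Together with (2.3), this concludes the proof."** The skeleton of the printed proof of
Thm. 2.3 with its displayed divisibilities as inputs BY NAME, over a domain `R` (`Λ_𝒪^{ur}`,
componentwise a power-series ring over a complete DVR): `C`, `C₀`, `CS` stand for
`Ch(X_ac(A_g))Λ^{ur}`, `Ch(X^{Σ₀}_ac(A_g))Λ^{ur}`, `Ch(X^Σ_ac(A_g))Λ^{ur}` and `L`, `L₀`, `LS` for
`L_p(g)`, `L^{Σ₀}_p(g)`, `L^Σ_p(g)`, where `Σ₀ ⊇ {ℓ ∣ M}` and `Σ` is arbitrary. Inputs: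
`h23 : (L) ⊆ C` — (2.3), the Euler-system divisibility ([CH18] (4.7)/§5.2/Thm. 5.7/Thm. 6.1,
[LV19, Thm. 4.7], [CGS23, Thm. 5.5.1], [CGLS22], [Cha05]/[MN19], [BCK21, Thm. 5.2]; see the module
docstring for the standing hypotheses of [CH18]/[LV19] at the weights used);
`h25 : C₀ ⊆ (L₀)` — (2.5) for `Σ₀` (⇐ (2.4) = [FW21, Thm. 4.41] PREPRINT, [FO12, Cor. 7.2.1],
[CGS23, Prop. 1.4.5], [JSW17, Cor. 3.4.2]); the factorisations `C₀ = C·(P₀)`, `L₀ ~ L·P₀`,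
`CS = C·(P)`, `LS ~ L·P` with `P₀ ≠ 0` (relaxed local conditions at `Σ` / removed Euler factors;
[JSW17, §3], [Ski16, Prop. 2.3.3]). Conclusion: `C = (L)` and `CS = (LS)` — the equality of Thm. 2.3
for every `Σ` (torsionness is the separate input [BCK21, Thm. 5.2]). Ideal bookkeeping; nothing
arithmetic is proved. [cite: Castella2018Erratum, proof of Thm. 2.3 (pp. 3–4), (2.3)–(2.5)] -/
theorem charIdeal_eq_of_thm23_inputs {C C₀ CS : Ideal R} {L L₀ LS P₀ P : R}
    (h23 : Ideal.span {L} ≤ C) (h25 : C₀ ≤ Ideal.span {L₀})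
    (hP₀ : P₀ ≠ 0) (hC₀ : C₀ = C * Ideal.span {P₀}) (hL₀ : Associated L₀ (L * P₀))
    (hCS : CS = C * Ideal.span {P}) (hLS : Associated LS (L * P)) :
    C = Ideal.span {L} ∧ CS = Ideal.span {LS} := by
  have hC : C = Ideal.span {L} :=
    le_antisymm (le_span_singleton_of_imprimitive hP₀ hC₀ hL₀ h25) h23
  refine ⟨hC, ?_⟩
  rw [hCS, hC, Ideal.span_singleton_mul_span_singleton,
    Ideal.span_singleton_eq_span_singleton.mpr hLS]

end Skeleton

/-! ### §2 The approximating weights of the proof of Thm. 1.1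

The congruence weights of [Ski16, § 2.6] / erratum p. 4 (a): `k > 2`, `k ≡ 2 (mod (p−1)p^{m−1})`
(level `m ≥ 1`; at `m = 1` the erratum's `k_m ≡ 2 (mod p−1)`). No predicate is introduced: every
statement carries the clauses `2 < k`, `k ≡ 2 [MOD (p − 1) * p ^ (m − 1)]` as hypotheses. -/

section Weights

variable {p m k : ℕ}

/-- Approximating weights exist at every level: `k_m := 2 + (p−1)p^{m−1}` (`k_1 = p + 1`).
[cite: Skinner2016PacificMC, §2.6] -/
theorem exists_approxWeight (hp : 2 ≤ p) (m : ℕ) :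
    ∃ k : ℕ, 2 < k ∧ k ≡ 2 [MOD (p - 1) * p ^ (m - 1)] := by
  refine ⟨2 + (p - 1) * p ^ (m - 1), ?_, ?_⟩
  · have h1 : 0 < (p - 1) * p ^ (m - 1) :=
      Nat.pos_of_ne_zero (Nat.mul_ne_zero (by omega) (pow_ne_zero _ (by omega)))
    exact Nat.lt_add_of_pos_right h1
  · exact ((Nat.modEq_iff_dvd' (by omega)).mpr (by simp)).symm

/-- An approximating weight of level `m` satisfies the erratum's (a): `k ≡ 2 (mod p−1)`.
[folklore] -/
theorem modEq_two_of_weight (hmod : k ≡ 2 [MOD (p - 1) * p ^ (m - 1)]) : k ≡ 2 [MOD (p - 1)] :=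
  Nat.ModEq.of_mul_right _ hmod

/-- The modulus divides `k − 2`. [folklore] -/
theorem dvd_sub_two_of_weight (hk : 2 < k) (hmod : k ≡ 2 [MOD (p - 1) * p ^ (m - 1)]) :
    (p - 1) * p ^ (m - 1) ∣ k - 2 :=
  (Nat.modEq_iff_dvd' hk.le).mp hmod.symm

/-- **The numerical content of "(a) and (b) follow from Hida theory" at the level of weight
characters:** for an approximating weight `k` of level `m ≥ 1` and every integer `u` prime to `p`
(`u ∈ ℤ_p^×` read modulo `p^m`), `u^{k−2} ≡ 1 (mod p^m)` — Euler's theorem with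
`φ(p^m) = (p−1)p^{m−1} ∣ k−2`. So the weight-`k` and weight-`2` specialisations of
`Λ_W = ℤ_p⟦1+pℤ_p⟧` agree modulo `p^m` ([Ski16, § 2.6]); the passage from there to the lattices
(b) `T_{g_m}/p^m ≃ T/p^m` is Hida theory and is NOT proved here. [cite: Skinner2016PacificMC, §2.6] -/
theorem pow_sub_two_modEq_one (hp : p.Prime) (hm : 1 ≤ m) (hk : 2 < k)
    (hmod : k ≡ 2 [MOD (p - 1) * p ^ (m - 1)]) {u : ℕ} (hu : u.Coprime p) :
    u ^ (k - 2) ≡ 1 [MOD p ^ m] := by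
  have htot : Nat.totient (p ^ m) = (p - 1) * p ^ (m - 1) := by
    rw [Nat.totient_prime_pow hp (by omega), mul_comm]
  obtain ⟨c, hc⟩ := dvd_sub_two_of_weight hk hmod
  have hEuler : u ^ Nat.totient (p ^ m) ≡ 1 [MOD p ^ m] :=
    Nat.ModEq.pow_totient (Nat.Coprime.pow_right _ hu)
  rw [hc, ← htot, pow_mul]
  simpa using hEuler.pow c

/-- **Every approximating weight satisfies `p ≤ k − 1`** (`p` prime: `p − 1 ∣ k − 2 ≠ 0` forces
`k − 2 ≥ p − 1`). [folklore] -/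
theorem prime_le_sub_one_of_weight (hp : p.Prime) (hk : 2 < k)
    (hmod : k ≡ 2 [MOD (p - 1) * p ^ (m - 1)]) : p ≤ k - 1 := by
  have h1 : p - 1 ∣ k - 2 := dvd_trans (Dvd.intro _ rfl) (dvd_sub_two_of_weight hk hmod)
  have h2 : p - 1 ≤ k - 2 := Nat.le_of_dvd (by omega) h1
  have := hp.two_le
  omega

/-- Hence `p ∣ (k−1)!` for every approximating weight `k`. [folklore] -/
theorem prime_dvd_factorial_sub_one_of_weight (hp : p.Prime) (hk : 2 < k)
    (hmod : k ≡ 2 [MOD (p - 1) * p ^ (m - 1)]) : p ∣ (k - 1)! :=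
  (Nat.Prime.dvd_factorial hp).mpr (prime_le_sub_one_of_weight hp hk hmod)

/-- For level `m ≥ 2` the modulus `(p−1)p^{m−1}` is at least `p`, so `p ≤ k − 2` and
`p ∣ (k−2)!`. [folklore] -/
theorem prime_dvd_factorial_sub_two_of_weight (hp : p.Prime) (hm : 2 ≤ m) (hk : 2 < k)
    (hmod : k ≡ 2 [MOD (p - 1) * p ^ (m - 1)]) : p ∣ (k - 2)! := by
  refine (Nat.Prime.dvd_factorial hp).mpr ?_
  have h2 : (p - 1) * p ^ (m - 1) ≤ k - 2 := Nat.le_of_dvd (by omega) (dvd_sub_two_of_weight hk hmod)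
  have h3 : p ≤ (p - 1) * p ^ (m - 1) := by
    have hp2 := hp.two_le
    calc p = 1 * p ^ 1 := by simp
      _ ≤ (p - 1) * p ^ (m - 1) :=
        Nat.mul_le_mul (by omega) (Nat.pow_le_pow_right hp.pos (by omega))
  exact h3.trans h2

/-- The FIRST weight escapes the factorial: `k_1 − 2 = p − 1` and `p ∤ (p−1)!`. [folklore] -/
theorem not_prime_dvd_factorial_first_weight (hp : p.Prime) : ¬ p ∣ (p + 1 - 2)! := by
  have h : p + 1 - 2 = p - 1 := by omega
  rw [h, Nat.Prime.dvd_factorial hp]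
  have := hp.two_le
  omega

end Weights

/-! ### §3 The standing hypotheses of [CH18] and [LV19] at the approximating weights

[CH18] Hypothesis (H)(a), verbatim: "`p ∤ 2(2r−1)!Nφ(N)`" for a newform of weight `2r` and level
`N` (Math. Ann. 370 (2018) §1, "assumed throughout"; §4.2; behind the Fontaine–Laffaille
description of the Bloch–Kato groups in the proofs of §6, "By the hypothesis `p > 2r−1`").
[LV19] §2.2, first clause of the excluded set `Ξ`, verbatim: "`p ∣ 6N(k−2)!φ(N)c_f`" (then
`p ∈ Ξ` and `(f, K, 𝔭)` is NOT admissible, Def. 2.1; Assumption 2.3 "The triple `(f,K,𝔭)` is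
admissible" is in force "throughout this article"). These are HYPOTHESES of the cited papers; the
two theorems below evaluate their arithmetic clauses at the erratum's weights — bookkeeping for
the queries Q1 (x11b, X11B-AUDIT §5) / Q3 (this unit), NOT claims that any theorem is false. -/

section CitedHypotheses

variable {p m k r : ℕ}

/-- **Query Q1 made kernel-precise (bookkeeping; NOT a claim that any theorem is false).** At
every approximating weight `k = 2r` (any level `m ≥ 1`, any prime `p`) one has `p ∣ (2r−1)!`,
hence `p ∣ 2(2r−1)!Mφ(M)`: [CH18]'s standing Hypothesis (H)(a) "`p ∤ 2(2r−1)!Nφ(N)`" is not met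
for `g_m ∈ S_{2r}(Γ₀(M))` at `p`, whatever the level `M` — while the erratum's proof of Thm. 2.3
invokes [CH18, (4.7), §5.2, Thm. 5.7, Thm. 6.1] for `g = g_m`. Whether the statements used
survive outside (H)(a) is not addressed in the erratum. [cite: CastellaHsieh2018, §1 Hypothesis (H)(a)]
[cite: Castella2018Erratum, proof of Thm. 2.3 (p. 3) and of Thm. 1.1 (p. 4) item (a)] -/
theorem dvd_hypHa_modulus_of_weight (hp : p.Prime) (hk : 2 < 2 * r)
    (hmod : 2 * r ≡ 2 [MOD (p - 1) * p ^ (m - 1)]) (M : ℕ) :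
    p ∣ 2 * (2 * r - 1)! * M * Nat.totient M := by
  have h1 : p ∣ (2 * r - 1)! := prime_dvd_factorial_sub_one_of_weight hp hk hmod
  exact Dvd.dvd.mul_right (Dvd.dvd.mul_right (Dvd.dvd.mul_left h1 2) M) _

/-- **The `Ξ`-clause of [LV19] at the approximating weights (bookkeeping; NOT a claim that any
theorem is false):** for every approximating weight `k` of level `m ≥ 2`, `p ∣ (k−2)!`, hence
`p ∣ 6M(k−2)!φ(M)c` for any level `M` and any `c = c_{g_m}`: `p ∈ Ξ` for `g_m` and [LV19]'s
Assumption 2.3 is not met — while the erratum's proof of Thm. 2.3 takes its Kolyvagin system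
(2.1) from [LV19, Thm. 4.7] for `g = g_m`, and the limiting argument of Thm. 1.1 needs the `g_m`
for cofinally many `m`. (`Ξ`'s big-image clause is not decidable here; X11B-AUDIT §5 Q1.)
[cite: LongoVigni2019, §2.2 and Assumption 2.3] [cite: Castella2018Erratum, proof of Thm. 2.3 (p. 3), (2.1)] -/
theorem dvd_xi_modulus_of_weight (hp : p.Prime) (hm : 2 ≤ m) (hk : 2 < k)
    (hmod : k ≡ 2 [MOD (p - 1) * p ^ (m - 1)]) (M c : ℕ) :
    p ∣ 6 * M * (k - 2)! * Nat.totient M * c := by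
  have h1 : p ∣ (k - 2)! := prime_dvd_factorial_sub_two_of_weight hp hm hk hmod
  exact Dvd.dvd.mul_right (Dvd.dvd.mul_right (Dvd.dvd.mul_left h1 _) _) _

/-- At level `m = 1` the least weight `k_1 = p + 1` does NOT trigger the `Ξ`-clause through
`(k−2)!` (`p ∤ (p−1)!`): there the clause reduces to `p ∣ 6Mφ(M)c`. Recorded so that the previous
statement is not over-read. [folklore] -/
theorem dvd_xi_modulus_first_weight_iff (hp : p.Prime) (M c : ℕ) :
    p ∣ 6 * M * (p + 1 - 2)! * Nat.totient M * c ↔ p ∣ 6 * M * Nat.totient M * c := by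
  have hfac : ¬ p ∣ (p + 1 - 2)! := not_prime_dvd_factorial_first_weight hp
  have hpr : Prime p := hp.prime
  constructor
  · intro h
    have h' : p ∣ 6 * M * Nat.totient M * c * (p + 1 - 2)! := by
      refine dvd_trans h (dvd_of_eq ?_); ring
    exact (hpr.dvd_or_dvd h').resolve_right hfac
  · intro h
    have : p ∣ 6 * M * Nat.totient M * c * (p + 1 - 2)! := Dvd.dvd.mul_right h _
    refine dvd_trans this (dvd_of_eq ?_); ring

end CitedHypotheses

/-! ### §4 The input "`L_p(f) ≠ 0`" of the limiting argument -/

section Nonvanishing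

/-- **"using the nonvanishing of `L_p(f)` that follows from the work of Cornut–Vatsal [CV07] and
the explicit reciprocity law in [Cas20, Thm. 5.3]"** (erratum p. 4) — in route R1's application
this input of the skeleton (`hL : L ≠ 0` in
`CongruenceLimit.isTorsion_and_charIdeal_eq_of_congruences`) costs nothing: the PUBLISHED link
(BDP) = Cas18 Thm. 3.2 (`LambdaAdicShadow.WaldspurgerAt`) gives `L_p(f)(𝟙) = u·((1 − a_p p⁻¹)·
log_{ω_E} P_K)²` with `u` a unit, and `log_{ω_E} P_K ≠ 0` for the non-torsion Heegner point `P_K`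
(`heegnerDatumSupply_of_caiShuTian`), so the constant term `L_p(f)(𝟙) = L(0)` is nonzero and hence
so is the power series. This lemma is the last (trivial) step. [folklore] -/
theorem ne_zero_of_constantCoeff_ne_zero {A : Type*} [Semiring A] {L : PowerSeries A}
    (h : PowerSeries.constantCoeff L ≠ 0) : L ≠ 0 := by
  rintro rfl
  exact h (map_zero _)

end Nonvanishing

end Summit.BirchSwinnertonDyer.Rank1Residual.X11b.Thm23

end
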